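import Mathlib
import Literature.RepresentationTheory.FiniteGroups.InducedClassFunction
import Literature.RepresentationTheory.FiniteGroups.GLBlockParabolic
import Summits.MatrixMultiplication.MatrixMultiplication.Theorems.LieRankDesigns.Negative.Basics
import Summits.MatrixMultiplication.MatrixMultiplication.Theorems.SubgroupIdentityDesigns.Negative.GrassmannCharacter
import Summits.MatrixMultiplication.MatrixMultiplication.Theorems.SubgroupIdentityDesigns.Negative.FlagCharacter

/-!
# `[G : P'] ≥ q^{kl + k(k-1)/2}` for the flag stabiliser `P'` of type `(1^k; l)`

Degree bound for the sharper general-`k` budget lemma (crux `SubgroupIdentityDesigns`,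
stmt-MatrixMultiplication-14079; BLOCK-SLICES §2).  VALUE = theorem, NOT summit progress.

With `P' = flagStab F k l ≤ P_k = subspaceStab F k l ≤ G = GL_{k+l}(F)` (`FlagCharacter`):
* `relindex_ge` — `[P_k : P'] ≥ q^{0 + 1 + ⋯ + (k-1)}`: the block-diagonal matrices `diag(T, 1)`
    with
  `T` unit LOWER triangular `k × k` (`lowerUnit`, strictly-lower entries free) lie in `P_k` and in
  pairwise distinct cosets of `P'` — if `diag(T,1)⁻¹ diag(T',1) ∈ P'` then `T' = T A` with `A` upper
  triangular (frame characterisation `FlagCharacter.mem_flagStab_iff_frame`), and `A = T⁻¹ T'` is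
  also lower triangular (`Matrix.blockTriangular_inv_of_blockTriangular`), hence diagonal, hence
      `1`;
* `card_quotient_flagStab_ge` — **`[G : P'] ≥ q^{kl} · q^{∑_{i<k} i}`**
    (`Subgroup.relIndex_mul_index`
  with `GrassmannCharacter.card_quotient_ge : [G : P_k] ≥ q^{kl}`), `two_mul_sum_range`
  (`2 ∑_{i<k} i = k(k-1)`);
* over `𝔽_p`: `flagChar_one_ge` — `Ψ(1) = [G : P'] ≥ p^{kl} p^{∑_{i<k} i}` for `Ψ = flagChar`.
-/

set_option linter.dupNamespace false

noncomputable section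

open scoped BigOperators Matrix Classical
open Literature.RepresentationTheory.FiniteGroups
open Summit.MatrixMultiplication.MatrixMultiplication.Theorems.LieRankDesigns.Negative (GLm Mat)

namespace Summit.MatrixMultiplication.MatrixMultiplication.Theorems.SubgroupIdentityDesigns.Negative
namespace FlagDegree

open GrassmannCharacter (subspaceStab mem_subspaceStab_iff stdFrame mul_stdFrame_apply
  stdFrame_mul_castAdd card_quotient_ge)
open FlagCharacter (flagStab flagStab_le mem_flagStab_iff_frame flagChar flagChar_one)

section General

variable {F : Type} [Field F] [Fintype F] [DecidableEq F] {k l : ℕ}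

/-! ## Unit lower triangular `k × k` matrices -/

/-- The unit lower triangular matrix with strictly-lower entries `f i j` (`j < i`). -/
def lowerUnit (f : (i : Fin k) → Fin i → F) : Matrix (Fin k) (Fin k) F :=
  fun i j => if h : (j : ℕ) < i then f i ⟨j, h⟩ else if j = i then 1 else 0

omit [Fintype F] [DecidableEq F] in
/-- Strictly-lower entries. -/
theorem lowerUnit_apply_of_lt (f : (i : Fin k) → Fin i → F) {i j : Fin k} (h : (j : ℕ) < i) :
    lowerUnit f i j = f i ⟨j, h⟩ := by
  simp [lowerUnit, h]

omit [Fintype F] [DecidableEq F] in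
/-- Diagonal entries. -/
theorem lowerUnit_apply_diag (f : (i : Fin k) → Fin i → F) (i : Fin k) : lowerUnit f i i = 1 := by
  simp [lowerUnit]

omit [Fintype F] [DecidableEq F] in
/-- Strictly-upper entries vanish. -/
theorem lowerUnit_apply_of_gt (f : (i : Fin k) → Fin i → F) {i j : Fin k} (h : i < j) :
    lowerUnit f i j = 0 := by
  have h1 : ¬ ((j : ℕ) < i) := by rw [Fin.lt_def] at h; omega
  have h2 : j ≠ i := ne_of_gt h
  simp [lowerUnit, h1, h2]

omit [Fintype F] [DecidableEq F] in
/-- `lowerUnit f` is lower triangular. -/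
theorem lowerUnit_blockTriangular (f : (i : Fin k) → Fin i → F) :
    (lowerUnit f).BlockTriangular OrderDual.toDual := fun _ _ hij =>
  lowerUnit_apply_of_gt f (OrderDual.toDual_lt_toDual.mp hij)

omit [Fintype F] [DecidableEq F] in
/-- `det (lowerUnit f) = 1`. -/
theorem det_lowerUnit (f : (i : Fin k) → Fin i → F) : (lowerUnit f).det = 1 := by
  rw [Matrix.det_of_lowerTriangular _ (lowerUnit_blockTriangular f)]
  exact Finset.prod_eq_one fun i _ => lowerUnit_apply_diag f i

omit [Fintype F] [DecidableEq F] in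
/-- **Rigidity**: if `T' = T A` with `T, T'` unit lower triangular and `A` upper triangular then
`T = T'` (indeed `A = T⁻¹ T'` is lower and upper triangular with unit diagonal). -/
theorem eq_of_lowerUnit_mul {f g : (i : Fin k) → Fin i → F} {A : Matrix (Fin k) (Fin k) F}
    (hA : ∀ i j : Fin k, j < i → A i j = 0) (h : lowerUnit g = lowerUnit f * A) : f = g := by
  have hdet : IsUnit (lowerUnit f).det := by rw [det_lowerUnit]; exact isUnit_one
  have hAeq : A = (lowerUnit f)⁻¹ * lowerUnit g := by
    rw [h, ← Matrix.mul_assoc, Matrix.nonsing_inv_mul _ hdet, Matrix.one_mul]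
  have hlowInv : ((lowerUnit f)⁻¹).BlockTriangular OrderDual.toDual := by
    letI : Invertible (lowerUnit f) := Matrix.invertibleOfIsUnitDet _ hdet
    exact Matrix.blockTriangular_inv_of_blockTriangular (lowerUnit_blockTriangular f)
  have hAlow : A.BlockTriangular OrderDual.toDual := by
    rw [hAeq]
    exact hlowInv.mul (lowerUnit_blockTriangular g)
  have hAoff : ∀ i j : Fin k, i ≠ j → A i j = 0 := by
    intro i j hij
    rcases lt_or_gt_of_ne hij with h1 | h1
    · exact hAlow (OrderDual.toDual_lt_toDual.mpr h1)
    · exact hA i j h1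
  have hAdiag : ∀ i : Fin k, A i i = 1 := by
    intro i
    have h1 := congrFun (congrFun h i) i
    rw [lowerUnit_apply_diag, Matrix.mul_apply, Finset.sum_eq_single i, lowerUnit_apply_diag,
      one_mul] at h1
    · exact h1.symm
    · intro m _ hm
      rw [hAoff m i hm, mul_zero]
    · intro hi
      exact absurd (Finset.mem_univ i) hi
  have hA1 : A = 1 := by
    ext i j
    by_cases hij : i = j
    · subst hij
      rw [hAdiag, Matrix.one_apply_eq]
    · rw [hAoff i j hij, Matrix.one_apply_ne hij]
  rw [hA1, Matrix.mul_one] at h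
  funext i j
  have hj : (((⟨j, j.2.trans i.2⟩ : Fin k) : ℕ)) < i := j.2
  have e1 := congrFun (congrFun h i) ⟨j, j.2.trans i.2⟩
  rw [lowerUnit_apply_of_lt g hj, lowerUnit_apply_of_lt f hj] at e1
  exact e1.symm

/-! ## The block-diagonal lift `diag(T, 1) ∈ P_k` -/

/-- The `(k+l) × (k+l)` matrix `diag(lowerUnit f, 1)`. -/
def liftMat (f : (i : Fin k) → Fin i → F) : Matrix (Fin (k + l)) (Fin (k + l)) F :=
  Matrix.reindex finSumFinEquiv finSumFinEquiv
    (Matrix.fromBlocks (lowerUnit f) 0 0 (1 : Matrix (Fin l) (Fin l) F))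

omit [Fintype F] [DecidableEq F] in
/-- `det diag(T, 1) = 1`. -/
theorem det_liftMat (f : (i : Fin k) → Fin i → F) : (liftMat (l := l) f).det = 1 := by
  rw [liftMat, Matrix.det_reindex_self, Matrix.det_fromBlocks_zero₂₁, det_lowerUnit, Matrix.det_one,
    one_mul]

/-- `diag(T, 1)` as an element of `GL_{k+l}(F)`. -/
def liftGL (f : (i : Fin k) → Fin i → F) : GL (Fin (k + l)) F :=
  Matrix.GeneralLinearGroup.mkOfDetNeZero (liftMat f) (by rw [det_liftMat]; exact one_ne_zero)

omit [Fintype F] [DecidableEq F] in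
/-- Upper-left entries of the lift. -/
theorem liftGL_castAdd_castAdd (f : (i : Fin k) → Fin i → F) (i j : Fin k) :
    ((liftGL (l := l) f : GL (Fin (k + l)) F) : Matrix (Fin (k + l)) (Fin (k + l)) F)
        (Fin.castAdd l i) (Fin.castAdd l j) = lowerUnit f i j := by
  show liftMat f _ _ = _
  simp [liftMat, Matrix.reindex_apply, Matrix.submatrix_apply]

omit [Fintype F] [DecidableEq F] in
/-- Lower-left entries of the lift vanish. -/
theorem liftGL_natAdd_castAdd (f : (i : Fin k) → Fin i → F) (i : Fin l) (j : Fin k) :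
    ((liftGL (l := l) f : GL (Fin (k + l)) F) : Matrix (Fin (k + l)) (Fin (k + l)) F)
        (Fin.natAdd k i) (Fin.castAdd l j) = 0 := by
  show liftMat f _ _ = _
  simp [liftMat, Matrix.reindex_apply, Matrix.submatrix_apply]

omit [Fintype F] [DecidableEq F] in
/-- The lift lies in `P_k`. -/
theorem liftGL_mem (f : (i : Fin k) → Fin i → F) : (liftGL f : GL (Fin (k + l)) F) ∈ subspaceStab F
    k l :=
  (mem_subspaceStab_iff _).mpr fun i j => liftGL_natAdd_castAdd f i j

omit [Fintype F] in
/-- **Distinct cosets**: `(liftGL f)⁻¹ liftGL g ∈ P'` forces `f = g`. -/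
theorem eq_of_inv_mul_mem {f g : (i : Fin k) → Fin i → F}
    (hmem : (liftGL f : GL (Fin (k + l)) F)⁻¹ * liftGL g ∈ flagStab F k l) : f = g := by
  obtain ⟨A, hA, hE⟩ := (mem_flagStab_iff_frame _).mp hmem
  have h2 : ((liftGL f : GL (Fin (k + l)) F) : Matrix (Fin (k + l)) (Fin (k + l)) F) *
      ((((liftGL f : GL (Fin (k + l)) F)⁻¹ * liftGL g : GL (Fin (k + l)) F)) :
        Matrix (Fin (k + l)) (Fin (k + l)) F) =
      ((liftGL g : GL (Fin (k + l)) F) : Matrix (Fin (k + l)) (Fin (k + l)) F) := by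
    rw [← Units.val_mul, mul_inv_cancel_left]
  have hE' : ((liftGL g : GL (Fin (k + l)) F) : Matrix (Fin (k + l)) (Fin (k + l)) F) *
      stdFrame F k l =
      ((liftGL f : GL (Fin (k + l)) F) : Matrix (Fin (k + l)) (Fin (k + l)) F) * stdFrame F k l * A
      := by
    rw [← h2, Matrix.mul_assoc, hE, Matrix.mul_assoc]
  have hT : lowerUnit g = lowerUnit f * A := by
    ext i j
    have e1 := congrFun (congrFun hE' (Fin.castAdd l i)) j
    rw [mul_stdFrame_apply, liftGL_castAdd_castAdd, Matrix.mul_apply] at e1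
    rw [e1, Matrix.mul_apply]
    refine Finset.sum_congr rfl fun m _ => ?_
    rw [mul_stdFrame_apply, liftGL_castAdd_castAdd]
  exact eq_of_lowerUnit_mul hA hT

/-! ## The index bounds -/

/-- **`[P_k : P'] ≥ q^{∑_{i<k} i}`.** -/
theorem relindex_ge :
    Fintype.card F ^ (∑ i ∈ Finset.range k, i) ≤ (flagStab F k l).relIndex (subspaceStab F k l) :=
        by
  let emb : ((i : Fin k) → Fin i → F) →
      (subspaceStab F k l) ⧸ (flagStab F k l).subgroupOf (subspaceStab F k l) :=
    fun f => ((⟨liftGL f, liftGL_mem f⟩ : subspaceStab F k l) :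
      (subspaceStab F k l) ⧸ (flagStab F k l).subgroupOf (subspaceStab F k l))
  have hinj : Function.Injective emb := by
    intro f g hfg
    have hmem : (⟨liftGL f, liftGL_mem f⟩ : subspaceStab F k l)⁻¹ * ⟨liftGL g, liftGL_mem g⟩ ∈
        (flagStab F k l).subgroupOf (subspaceStab F k l) := QuotientGroup.eq.mp hfg
    rw [Subgroup.mem_subgroupOf] at hmem
    exact eq_of_inv_mul_mem (by simpa using hmem)
  have hcard := Fintype.card_le_of_injective emb hinj
  rw [Fintype.card_pi] at hcard
  simp only [Fintype.card_fun, Fintype.card_fin] at hcard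
  rw [Finset.prod_pow_eq_pow_sum, Fin.sum_univ_eq_sum_range (fun i => i) k] at hcard
  have hrel : (flagStab F k l).relIndex (subspaceStab F k l) =
      Nat.card ((subspaceStab F k l) ⧸ (flagStab F k l).subgroupOf (subspaceStab F k l)) :=
    Subgroup.index_eq_card _
  rw [hrel, Nat.card_eq_fintype_card]
  exact hcard

/-- **`[G : P'] ≥ q^{kl} · q^{∑_{i<k} i}`.** -/
theorem card_quotient_flagStab_ge :
    Fintype.card F ^ (k * l) * Fintype.card F ^ (∑ i ∈ Finset.range k, i) ≤
      Fintype.card (GL (Fin (k + l)) F ⧸ flagStab F k l) := by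
  have h1 : (flagStab F k l).index =
      (flagStab F k l).relIndex (subspaceStab F k l) * (subspaceStab F k l).index :=
    (Subgroup.relIndex_mul_index flagStab_le).symm
  have h2 : Fintype.card F ^ (k * l) ≤ (subspaceStab F k l).index := by
    rw [Subgroup.index_eq_card, Nat.card_eq_fintype_card]
    exact card_quotient_ge
  have h3 := relindex_ge (F := F) (k := k) (l := l)
  have h4 : (flagStab F k l).index = Fintype.card (GL (Fin (k + l)) F ⧸ flagStab F k l) := by
    rw [Subgroup.index_eq_card, Nat.card_eq_fintype_card]
  rw [← h4, h1, mul_comm]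
  exact Nat.mul_le_mul h3 h2

/-- `2 ∑_{i<k} i = k(k-1)`. -/
theorem two_mul_sum_range (k : ℕ) : 2 * ∑ i ∈ Finset.range k, i = k * (k - 1) := by
  rw [mul_comm, Finset.sum_range_id_mul_two]

end General

/-! ## Over `𝔽_p` -/

variable {p : ℕ} [hp : Fact p.Prime] {k l : ℕ}

/-- **`(Ψ 1).re ≥ p^{kl} · p^{∑_{i<k} i}`** for `Ψ = Ind_{P'}^G 1`. -/
theorem flagChar_one_ge :
    ((p ^ (k * l) * p ^ (∑ i ∈ Finset.range k, i) : ℕ) : ℝ) ≤ (flagChar (ZMod p) k l 1).re := by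
  rw [flagChar_one]
  simp only [Complex.natCast_re, Nat.cast_le]
  have h := card_quotient_flagStab_ge (F := ZMod p) (k := k) (l := l)
  rwa [ZMod.card] at h

end FlagDegree
end Summit.MatrixMultiplication.MatrixMultiplication.Theorems.SubgroupIdentityDesigns.Negative
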